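import Literature.NumberTheory.PAdicHodge.WeilPairingPeriodExtension
import HarnessLib

/-!
# The cochain presenting `η ∪ κ` in LEGENDRE FORM: `g(σ) = ∫_{ησ} η · σ b_ω − ∫_{ησ} ω · σ b_η`, its values modulo
# `ℤ_p · t` (the resolution `x̃ : T_pW → B_dR⁺`) and its `θ`-projection

Topic `Literature/NumberTheory/PAdicHodge`; THEOREMS ONLY (no definition, no named fact, no instance, no `sorry`). Sequel of
`WeilPairingPeriodExtension` (Kato's formal argument `isCoboundaryLift_weilContPairingPadic_right`: `η ∪_{e_∞} κ` is presented by
`σ ↦ −⟨η σ, σ ỹ⟩~` whenever `1 ⊗ 1 ⊗ κ = ∂ỹ` in `B ⊗ V_pW`) and of `TateTwistPeriodLine` (the period line `ι : ℤ_p(1) → B_dR⁺(F)`,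
`ε^a ↦ a · t`, and the ambient representation `galRepr`).

THE POINT. The tree presents `η ∪ κ` through an element `ỹ = Φ⁻¹(b_ω, b_η) ∈ B_dR ⊗ V_pW` obtained by INVERTING the period matrix
(`KummerFilZeroCoboundary*`, which needs `b_ω ∈ Fil¹` and produces a cochain about whose values one only knows `∈ Fil¹`,
`TatePairingCochainFilOne`). Kato's proof of the explicit reciprocity law (LNM 1553, II, Lemma 1.4.3–1.4.5) needs instead a
presenting cochain with RECOGNISABLE values (values in his `X = (B⁺_crys)^{φ=p}`; the line's `X₂ ⊂ B₂`). The Legendre relation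
`∫_S ω ∫_T η − ∫_S η ∫_T ω = ι(e_∞(S, T))` (Fontaine 1982 §5, Colmez 1992 §2; in the tree `BdRPeriodDeterminantOfWeil` up to a constant
of `F^×`, to be absorbed in `∫η`) makes the inversion unnecessary: for ANY pair of `Γ_F`-equivariant additive period maps
`Pω, Pη : T_pW → B_dR⁺(F)` satisfying it and ANY pair `(b_ω, b_η)` of elements of `B_dR⁺(F)` integrating `κ`
(`Pω(κ τ) = τ b_ω − b_ω`, `Pη(κ τ) = τ b_η − b_η` — brick K1 `AinfWeierstrassKummerIntegral(Eta)` for Kummer cocycles, with or without the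
constant `log_ω(P)`: Fontaine's own integrating element `log_W(ι[ũ])` of `BdRPlusFormalLogKummer` is allowed, `b_ω ∉ Fil¹`), the cochain

  `g(σ) := Pη(η σ) · σ b_ω − Pω(η σ) · σ b_η`

presents `η ∪_{e_∞} κ` through `ι` (§1, ★★ `isCoboundaryLift_legendreCochain` — the instance `Ỹ = B_dR⁺ × B_dR⁺`,
`⟨S, (y₁, y₂)⟩~ = Pη(S) y₁ − Pω(S) y₂` of `ContPairing.isCoboundaryLift_cupCocycle_right`, written out). Its values are controlled by the
RESOLUTION `x̃(a) := Pη(a) · b_ω − Pω(a) · b_η` (`a ∈ T_pW`): ★ `legendreCochain_eq_resolution_add_periodLine` —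
**`g(σ) = x̃(η σ) + ι(e_∞(κ σ, η σ))`**, so modulo `ι ∘ C(Γ_F, ℤ_p(1))` (invisible to the connecting class) the presenting cochain takes
its values in the `ℤ`-span of the TWO elements `x̃(v₀), x̃(v₁)` (§2; `gal_resolution`: `σ x̃(a) = x̃(σ a) + ι(e_∞(κ σ, σ a))`, i.e.
`∂x̃ = κ` in `Hom(T_pW, B_dR⁺) ≅ B_dR⁺ ⊗ V_pW(−1)` — Kato's `x` of Lemma 1.4.3 without `B_crys`). §3: when `Pω ⊆ Fil¹ = ker θ`,
**`θ(x̃(a)) = θ(Pη a) · θ(b_ω)`** (`thetaBdR_resolution`) — with Fontaine's integrating element `θ(b_ω) = log_ω(P)`, so the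
`θ`-projection of the presenting cochain is `log_ω(P)` times the weight-`0` Hodge–Tate component of `η`, the quantity the dual
exponential reads. §4: changing `(b_ω, b_η)` by `Γ_F`-invariant constants `(x, y)` changes `g` by the `1`-COCYCLE
`z(σ) = Pη(η σ) x − Pω(η σ) y` of `B_dR⁺` (`legendreShift_isCocycle`, `legendreCochain_shift`) — the slack `z` of the assembly socket
`ReciprocityCalibrationSocket.tatePairingPoint_eq_neg_trace_of_recognition`. Hence (§5, ★ `tatePairing_eq_invPadic_of_legendre`)
`⟨[η], [κ]⟩ = inv_∞[c]` for every continuous `c` presented by `g`, and the explicit reciprocity law [REC] at a completion is reduced to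
RECOGNISING THE TWO ELEMENTS `x̃(v₀), x̃(v₁) ∈ B_dR⁺` modulo `Fil²` (memo `Cruxes/StarredOptimalManinUnitFiveSeven/Lines/kato-lever-K3-legendre.md`).

Line `kato_lever` of crux K★ `stmt-BirchSwinnertonDyer-22226`; BSD / K★ / [REC] are NOT proved by any of this.

## References
* K. Kato, LNM 1553 (1993), Ch. II §1.2.4, proof of Lemma 1.4.3 (the element `x` with `∂x = a`, the cochain `⟨x, b τ⟩`). [Kato1993LNM1553]
* J.-M. Fontaine, *Formes différentielles et modules de Tate…*, Invent. Math. 65 (1982), §5 (the period pairing, Legendre). [Fontaine1982FormesDifferentielles]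
* P. Colmez, *Périodes p-adiques des variétés abéliennes*, Math. Ann. 292 (1992), §2 (`∫ω∫η′ − ∫η∫ω′ = 2iπ`). [Colmez1992PeriodesAbeliennes]
* J. Neukirch, A. Schmidt, K. Wingberg (2008), I §3 (1.3.2), I §4 (cup products on cochains). [NeukirchSchmidtWingberg2008]
-/

noncomputable section

open Field Function ValuativeRel WittVector

namespace Literature.NumberTheory.PAdicHodge

open Literature.NumberTheory.GaloisRepresentations
open Literature.NumberTheory.GaloisRepresentations.IsNonarchimedeanLocalField
open Literature.NumberTheory.GaloisCohomology
open Literature.NumberTheory.EllipticCurves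
open _root_.WeierstrassCurve

namespace BdRPlusTop

variable {F : Type} [Field F] [ValuativeRel F] [TopologicalSpace F] [IsNonarchimedeanLocalField F] [CharZero F]
  {p : ℕ} [Fact p.Prime] [Fact (¬ IsUnit (p : integerC F))] [IsAdicComplete (Ideal.span {(p : integerC F)}) (integerC F)]
  {K₀ : Type} [Field K₀] [Algebra K₀ F] (W : WeierstrassCurve K₀)
  (e : (k : ℕ) → geomTorsion W ((p ^ k : ℕ) : ℤ) → geomTorsion W ((p ^ k : ℕ) : ℤ) → AlgebraicClosure K₀)
  (hμ : ∀ k S T, e k S T ^ (p ^ k) = 1) (hadd₁ : ∀ k S₁ S₂ T, e k (S₁ + S₂) T = e k S₁ T * e k S₂ T)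
  (hadd₂ : ∀ k S T₁ T₂, e k S (T₁ + T₂) = e k S T₁ * e k S T₂)
  (hgal : ∀ k (σ : absoluteGaloisGroup K₀) (S T : geomTorsion W ((p ^ k : ℕ) : ℤ)), σ • e k S T = e k (σ • S) (σ • T))
  (hcompat : ∀ k (S T : geomTorsion W ((p ^ (k + 1) : ℕ) : ℤ)),
    e k (torsionMulHom W (p ^ (k + 1)) (p ^ k) p (pow_succ p k).symm S)
      (torsionMulHom W (p ^ (k + 1)) (p ^ k) p (pow_succ p k).symm T) = e (k + 1) S T ^ p)
  -- the period pair and its Legendre relation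
  {Pω Pη : W.tateModule p →+ BdRPlusTop F p}
  (hPω : ∀ (σ : absoluteGaloisGroup F) (a : W.tateModule p), gal F p σ (Pω a) = Pω (restrictedTateRep W F p σ a))
  (hPη : ∀ (σ : absoluteGaloisGroup F) (a : W.tateModule p), gal F p σ (Pη a) = Pη (restrictedTateRep W F p σ a))
  (hLeg : ∀ S T : W.tateModule p, Pω S * Pη T - Pη S * Pω T =
    periodLine F p ((weilContPairingPadic W F p e hμ hadd₁ hadd₂ hgal hcompat).toLin S T))

/-- `σ(τ b) = (στ) b` on `B_dR⁺(F)` (`galBdRPlus_mul`). [cite: FontaineAsterisque223III, Exp. II §1.5] -/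
theorem gal_gal (σ τ : absoluteGaloisGroup F) (b : BdRPlusTop F p) : gal F p σ (gal F p τ b) = gal F p (σ * τ) b := by
  rw [← (of F p).apply_symm_apply b, gal_of, gal_of, gal_of, galBdRPlus_mul]

omit [ValuativeRel F] [TopologicalSpace F] [IsNonarchimedeanLocalField F] [CharZero F] [Fact (¬ IsUnit (p : integerC F))]
  [IsAdicComplete (Ideal.span {(p : integerC F)}) (integerC F)] in
/-- The action on the Tate module underlying the `TopRep` of `restrictedTateRep` (unfolding). [cite: SilvermanAEC2009, III §7] -/
private theorem toTopRep_ρ_apply (σ : absoluteGaloisGroup F) (a : W.tateModule p) :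
    (restrictedTateRep W F p).toTopRep.ρ σ a = restrictedTateRep W F p σ a := rfl

/-! ## §1 The Legendre-form cochain presents `η ∪ κ` -/

include hPω hPη hLeg in
/-- ★★ **Kato II Lemma 1.4.3, formal part, in Legendre form.** Let `Pω, Pη : T_pW → B_dR⁺(F)` be `Γ_F`-equivariant additive period maps
with the Legendre relation `Pω(S) Pη(T) − Pη(S) Pω(T) = ι(e_∞(S, T))`, and let `(b_ω, b_η)` integrate the cocycle `κ`:
`Pω(κ τ) = τ b_ω − b_ω`, `Pη(κ τ) = τ b_η − b_η`. Then for EVERY cocycle `η` the cochain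
**`g(σ) = Pη(η σ) · σ b_ω − Pω(η σ) · σ b_η` presents `η ∪_{e_∞} κ` through the period line**:
`ι((η ∪ κ)(σ, τ)) = σ g(τ) − g(στ) + g(σ)`. No `Fil¹`-condition on `b_ω` and no inversion of the period matrix is needed.
[cite: Kato1993LNM1553, Ch. II, proof of Lemma 1.4.3] [cite: Fontaine1982FormesDifferentielles, §5] [cite: Colmez1992PeriodesAbeliennes, §2] -/
theorem isCoboundaryLift_legendreCochain (η κ : contOneCocycles (restrictedTateRep W F p).toTopRep) {bω bη : BdRPlusTop F p}
    (hbω : ∀ τ, Pω (κ.1 τ) = gal F p τ bω - bω) (hbη : ∀ τ, Pη (κ.1 τ) = gal F p τ bη - bη) :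
    IsCoboundaryLift (ρ := tateModuleMuPadic F p) (galRepr F p) (periodLine F p)
      (fun σ => Pη (η.1 σ) * gal F p σ bω - Pω (η.1 σ) * gal F p σ bη)
      ((weilContPairingPadic W F p e hμ hadd₁ hadd₂ hgal hcompat).cupCocycle η κ) := fun σ τ => by
  rw [ContPairing.cupCocycle_apply_eq_smul, ← hLeg, galRepr_apply, toTopRep_ρ_apply]
  have e1 : Pω (restrictedTateRep W F p σ (κ.1 τ)) = gal F p (σ * τ) bω - gal F p σ bω := by
    rw [← hPω, hbω, map_sub, gal_gal]
  have e2 : Pη (restrictedTateRep W F p σ (κ.1 τ)) = gal F p (σ * τ) bη - gal F p σ bη := by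
    rw [← hPη, hbη, map_sub, gal_gal]
  have e3 : η.1 (σ * τ) = η.1 σ + restrictedTateRep W F p σ (η.1 τ) := η.2 σ τ
  simp only [e3, map_add, map_sub, map_mul, hPω, hPη, gal_gal, e1, e2]
  ring

/-! ## §2 The resolution `x̃(a) = Pη(a) b_ω − Pω(a) b_η`: `∂x̃ = κ`, and `g = x̃ ∘ η + ι ∘ (e_∞(κ, η))` -/

include hPω hPη hLeg in
/-- ★ **`∂x̃ = κ`**: for `x̃(a) := Pη(a) · b_ω − Pω(a) · b_η` one has **`σ(x̃ a) = x̃(σ a) + ι(e_∞(κ σ, σ a))`** — the element `x` of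
Kato's Lemma 1.4.3 (`x ∈ B ⊗ V` with `(σ − 1) x = κ(σ)`), read as the map `a ↦ ⟨a, x⟩ : T_pW → B_dR⁺` and written WITHOUT inverting
the period matrix. [cite: Kato1993LNM1553, Ch. II, proof of Lemma 1.4.3] [cite: Fontaine1982FormesDifferentielles, §5] -/
theorem gal_resolution (κ : contOneCocycles (restrictedTateRep W F p).toTopRep) {bω bη : BdRPlusTop F p}
    (hbω : ∀ τ, Pω (κ.1 τ) = gal F p τ bω - bω) (hbη : ∀ τ, Pη (κ.1 τ) = gal F p τ bη - bη)
    (σ : absoluteGaloisGroup F) (a : W.tateModule p) :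
    gal F p σ (Pη a * bω - Pω a * bη) =
      (Pη (restrictedTateRep W F p σ a) * bω - Pω (restrictedTateRep W F p σ a) * bη) +
        periodLine F p ((weilContPairingPadic W F p e hμ hadd₁ hadd₂ hgal hcompat).toLin (κ.1 σ)
          (restrictedTateRep W F p σ a)) := by
  rw [← hLeg, map_sub, map_mul, map_mul, hPω, hPη]
  have e1 : gal F p σ bω = bω + Pω (κ.1 σ) := by rw [hbω]; ring
  have e2 : gal F p σ bη = bη + Pη (κ.1 σ) := by rw [hbη]; ring
  rw [e1, e2]
  ring

include hLeg in
/-- ★ **`g = x̃ ∘ η + ι ∘ e_∞(κ, η)`**: the presenting cochain of §1 is **`g(σ) = x̃(η σ) + ι(e_∞(κ σ, η σ))`** — modulo the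
`ι(ℤ_p(1))`-valued continuous cochain `σ ↦ e_∞(κ σ, η σ)` (which does not change the presented class,
`IsCoboundaryLift.add_twoCoboundary`) the cochain takes its values in the `ℤ`-span of the resolution `x̃(T_pW)`, i.e. of the TWO
elements `x̃(v₀), x̃(v₁)` for a `ℤ_p`-basis `(v₀, v₁)`. [cite: Kato1993LNM1553, Ch. II, proof of Lemma 1.4.3] [cite: NeukirchSchmidtWingberg2008, I §3 (1.3.2)] -/
theorem legendreCochain_eq_resolution_add_periodLine (η κ : contOneCocycles (restrictedTateRep W F p).toTopRep)
    {bω bη : BdRPlusTop F p} (hbω : ∀ τ, Pω (κ.1 τ) = gal F p τ bω - bω) (hbη : ∀ τ, Pη (κ.1 τ) = gal F p τ bη - bη)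
    (σ : absoluteGaloisGroup F) :
    Pη (η.1 σ) * gal F p σ bω - Pω (η.1 σ) * gal F p σ bη =
      (Pη (η.1 σ) * bω - Pω (η.1 σ) * bη) +
        periodLine F p ((weilContPairingPadic W F p e hμ hadd₁ hadd₂ hgal hcompat).toLin (κ.1 σ) (η.1 σ)) := by
  rw [← hLeg]
  have e1 : gal F p σ bω = bω + Pω (κ.1 σ) := by rw [hbω]; ring
  have e2 : gal F p σ bη = bη + Pη (κ.1 σ) := by rw [hbη]; ring
  rw [e1, e2]
  ring

omit [CharZero F] [Algebra K₀ F] in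
/-- **The resolution is additive in `a`** (so its values on `T_pW` form the `ℤ`-span of `x̃(v₀), x̃(v₁)`).
[cite: Kato1993LNM1553, Ch. II §1.2.4] -/
theorem resolution_add (bω bη : BdRPlusTop F p) (a a' : W.tateModule p) :
    Pη (a + a') * bω - Pω (a + a') * bη = (Pη a * bω - Pω a * bη) + (Pη a' * bω - Pω a' * bη) := by
  rw [map_add, map_add]; ring

omit [CharZero F] [Algebra K₀ F] in
/-- The resolution on integer multiples: `x̃(n • a) = n · x̃(a)`. [cite: Kato1993LNM1553, Ch. II §1.2.4] -/
theorem resolution_zsmul (bω bη : BdRPlusTop F p) (n : ℤ) (a : W.tateModule p) :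
    Pη (n • a) * bω - Pω (n • a) * bη = (n : BdRPlusTop F p) * (Pη a * bω - Pω a * bη) := by
  rw [map_zsmul, map_zsmul, zsmul_eq_mul, zsmul_eq_mul]; ring

/-! ## §3 The `θ`-projection of the resolution -/

omit [Algebra K₀ F] in
/-- ★ **`θ(x̃ a) = θ(Pη a) · θ(b_ω)` when `Pω ⊆ Fil¹ = ker θ`** (the `ω`-periods lie in `Fil¹ B_dR⁺`: `AinfWeierstrassOmegaPeriod*`,
`AinfRamifiedOmegaPeriod*`). With Fontaine's integrating element `b_ω = log_W(ι[ũ])` one has `θ(b_ω) = log_ω(P)`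
(`BdRPlusFormalLogModFil.thetaBdR_eq_of_tendsto`), so the `θ`-projection of the presenting cochain is `log_ω(P) · θ(Pη(η σ))`,
`θ ∘ Pη` being the weight-`0` Hodge–Tate component — the datum read by the dual exponential. With the tree's `b_ω ∈ Fil¹`
(`AinfWeierstrassKummerIntegral.bOmega`) the projection is `0`. [cite: Kato1993LNM1553, Ch. II §1.2.4–1.2.5 and Lemma 1.4.3]
[cite: Fontaine1982FormesDifferentielles, §5] -/
theorem thetaBdR_resolution (hfil : ∀ a, Pω a ∈ (filOne F p).toIdeal) (bω bη : BdRPlusTop F p) (a : W.tateModule p) :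
    thetaBdR ((of F p).symm (Pη a * bω - Pω a * bη)) = thetaBdR ((of F p).symm (Pη a)) * thetaBdR ((of F p).symm bω) := by
  have h0 : thetaBdR ((of F p).symm (Pω a)) = 0 := by
    rw [← RingHom.mem_ker, ker_thetaBdR_eq_span]
    exact (mem_filOne_iff).1 (hfil a)
  simp only [map_sub, map_mul, h0, zero_mul, sub_zero]

/-- The same for the presenting cochain: `θ(g σ) = θ(Pη(η σ)) · θ(σ b_ω)` when `Pω ⊆ ker θ`.
[cite: Kato1993LNM1553, Ch. II §1.2.4–1.2.5 and Lemma 1.4.3] -/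
theorem thetaBdR_legendreCochain (hfil : ∀ a, Pω a ∈ (filOne F p).toIdeal)
    (η : contOneCocycles (restrictedTateRep W F p).toTopRep) (bω bη : BdRPlusTop F p) (σ : absoluteGaloisGroup F) :
    thetaBdR ((of F p).symm (Pη (η.1 σ) * gal F p σ bω - Pω (η.1 σ) * gal F p σ bη)) =
      thetaBdR ((of F p).symm (Pη (η.1 σ))) * thetaBdR ((of F p).symm (gal F p σ bω)) :=
  thetaBdR_resolution W hfil _ _ _

/-- If moreover `θ(b_ω) = ι_F(c)` is a constant of `F` (e.g. `c = log_ω(P)`), then `θ(σ b_ω) = ι_F(c)` for every `σ` (`θ` is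
`Γ_F`-equivariant and `Γ_F` fixes `F ⊆ ℂ_F`), so **`θ(g σ) = θ(Pη(η σ)) · c`**. [cite: FontaineAsterisque223III, Exp. II §1.5.2–1.5.5]
[cite: Kato1993LNM1553, Ch. II Lemma 1.4.3] -/
theorem thetaBdR_legendreCochain_of_thetaBdR_eq (hfil : ∀ a, Pω a ∈ (filOne F p).toIdeal)
    (η : contOneCocycles (restrictedTateRep W F p).toTopRep) {bω : BdRPlusTop F p} (bη : BdRPlusTop F p) {c : F}
    (hc : thetaBdR ((of F p).symm bω) = algebraMap F (CompletedAlgClosure F) c) (σ : absoluteGaloisGroup F) :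
    thetaBdR ((of F p).symm (Pη (η.1 σ) * gal F p σ bω - Pω (η.1 σ) * gal F p σ bη)) =
      thetaBdR ((of F p).symm (Pη (η.1 σ))) * algebraMap F (CompletedAlgClosure F) c := by
  rw [thetaBdR_legendreCochain W hfil]
  congr 1
  have h1 : (of F p).symm (gal F p σ bω) = galBdRPlus σ ((of F p).symm bω) := by
    rw [← (of F p).apply_symm_apply bω, gal_of, RingEquiv.symm_apply_apply, RingEquiv.symm_apply_apply]
  rw [h1, thetaBdR_galBdRPlus, hc, CompletedAlgClosure.smul_algebraMap]

/-! ## §4 Changing the integrating pair by `Γ_F`-invariant constants changes `g` by a cocycle -/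

include hPω hPη in
/-- ★ **The shift cocycle.** For `Γ_F`-invariant `x, y ∈ B_dR⁺(F)` (e.g. `ι_F(log_ω P)`, `ι_F` of an `η`-constant) the cochain
**`z(σ) = Pη(η σ) · x − Pω(η σ) · y` is a `1`-cocycle of `B_dR⁺`**: `z(στ) = z(σ) + σ z(τ)` (the hypothesis `hz` of the socket
`ReciprocityCalibrationSocket.tatePairingPoint_eq_neg_trace_of_recognition`). [cite: NeukirchSchmidtWingberg2008, I §3 (1.3.2)]
[cite: Kato1993LNM1553, Ch. II §1.4] -/
theorem legendreShift_isCocycle (η : contOneCocycles (restrictedTateRep W F p).toTopRep) {x y : BdRPlusTop F p}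
    (hx : ∀ σ, gal F p σ x = x) (hy : ∀ σ, gal F p σ y = y) (σ τ : absoluteGaloisGroup F) :
    Pη (η.1 (σ * τ)) * x - Pω (η.1 (σ * τ)) * y =
      (Pη (η.1 σ) * x - Pω (η.1 σ) * y) + galRepr F p σ (Pη (η.1 τ) * x - Pω (η.1 τ) * y) := by
  have e3 : η.1 (σ * τ) = η.1 σ + restrictedTateRep W F p σ (η.1 τ) := η.2 σ τ
  rw [e3, Pη.map_add, Pω.map_add, galRepr_apply, (gal F p σ).map_sub, (gal F p σ).map_mul, (gal F p σ).map_mul, hx, hy,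
    hPω, hPη]
  ring

/-- **Shifting the integrating pair.** If `(b_ω, b_η)` integrates `κ` then so does `(b_ω + x, b_η + y)` for `Γ_F`-invariant `x, y`
(`τ(b + x) − (b + x) = τ b − b`). [cite: Kato1993LNM1553, Ch. II Lemma 1.4.3] -/
theorem integrates_add_of_gal_eq {P : W.tateModule p →+ BdRPlusTop F p} (κ : contOneCocycles (restrictedTateRep W F p).toTopRep)
    {b x : BdRPlusTop F p} (hb : ∀ τ, P (κ.1 τ) = gal F p τ b - b) (hx : ∀ σ, gal F p σ x = x) (τ : absoluteGaloisGroup F) :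
    P (κ.1 τ) = gal F p τ (b + x) - (b + x) := by
  rw [map_add, hx, hb]; ring

/-- ★ **`g_{(b_ω + x, b_η + y)} = g_{(b_ω, b_η)} + z`** with the shift cocycle `z(σ) = Pη(η σ) x − Pω(η σ) y` (`x, y` invariant): the
presenting cochains attached to two integrating pairs differing by constants differ by a COCYCLE of `B_dR⁺` — e.g. Fontaine's
`log_W(ι[ũ])` versus the tree's `b_ω = log_W(ι[ũ]) − log_ω(P)`. [cite: Kato1993LNM1553, Ch. II Lemma 1.4.3] [cite: BlochKato1990, Ex. 3.10.1] -/
theorem legendreCochain_shift (η : contOneCocycles (restrictedTateRep W F p).toTopRep) {bω bη x y : BdRPlusTop F p}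
    (hx : ∀ σ, gal F p σ x = x) (hy : ∀ σ, gal F p σ y = y) (σ : absoluteGaloisGroup F) :
    Pη (η.1 σ) * gal F p σ (bω + x) - Pω (η.1 σ) * gal F p σ (bη + y) =
      (Pη (η.1 σ) * gal F p σ bω - Pω (η.1 σ) * gal F p σ bη) + (Pη (η.1 σ) * x - Pω (η.1 σ) * y) := by
  rw [map_add, map_add, hx, hy]; ring

/-! ## §5 `⟨[η], [κ]⟩ = inv_∞[c]` for every `c` presented by the Legendre cochain -/

variable [LocallyCompactSpace (absoluteGaloisGroup F)] [CharZero K₀] [W.IsElliptic]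

include hPω hPη hLeg in
/-- ★ **`⟨[η], [κ]⟩ = inv_∞[c]` for ANY continuous `2`-cocycle `c` of `ℤ_p(1)` presented by the Legendre cochain** (`ι` injective as
`θ` is onto): the tree's local Tate pairing of two classes, the second of which is integrated by `(b_ω, b_η)`, is the invariant of the
connecting class of `g(σ) = Pη(η σ) · σ b_ω − Pω(η σ) · σ b_η`. What remains for Kato's law is to RECOGNISE `g`, i.e. the two
elements `x̃(v₀), x̃(v₁)` of §2. [cite: Kato1993LNM1553, Ch. II §1.4, Thm. 1.4.1 (3) and proof of Lemma 1.4.3] -/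
theorem tatePairing_eq_invPadic_of_legendre (hF : Function.Surjective (fontaineTheta (integerC F) p))
    (η κ : contOneCocycles (restrictedTateRep W F p).toTopRep) {bω bη : BdRPlusTop F p}
    (hbω : ∀ τ, Pω (κ.1 τ) = gal F p τ bω - bω) (hbη : ∀ τ, Pη (κ.1 τ) = gal F p τ bη - bη)
    {c : contTwoCocycles (tateModuleMuPadic F p).toTopRep}
    (hc : IsCoboundaryLift (ρ := tateModuleMuPadic F p) (galRepr F p) (periodLine F p)
      (fun σ => Pη (η.1 σ) * gal F p σ bω - Pω (η.1 σ) * gal F p σ bη) c) :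
    tatePairing W F p e hμ hadd₁ hadd₂ hgal hcompat (oneCocycleClass _ η) (oneCocycleClass _ κ) =
      invPadic F p (twoCocycleClass _ c) := by
  rw [tatePairing_oneCocycleClass_eq_invPadic_twoCocycleClass,
    (isCoboundaryLift_legendreCochain W e hμ hadd₁ hadd₂ hgal hcompat hPω hPη hLeg η κ hbω hbη).unique
      (periodLine_injective hF) hc]

end BdRPlusTop

end Literature.NumberTheory.PAdicHodge

end
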